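import Mathlib
import Literature.Analysis.Convexity.AnisotropicPerimeterPolytopeUpper
import HarnessLib

/-!
# Lower facet bound for the anisotropic perimeter of a convex polytope, GIVEN separated facet cut-offs

Topic `Literature/Analysis/Convexity`; namespace `Literature.Analysis.Convexity`.
The lower half of the facet formula `P_K(P) = Σ_F h_K(ν_F) area(F)` (T2c of the facet-formula
programme) splits into (i) ANALYSIS: for cut-off functions `χ_j ∈ C¹_c`, `0 ≤ χ_j`, `Σ_j χ_j ≤ 1`,
with `χ_j = 0` on every other facet `F_k` (`k ≠ j`), and points `k_j ∈ K` (`K` convex, `0 ∈ K`), the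
field `φ = Σ_j χ_j k_j` is admissible and Gauss–Green for polytopes gives
`∫_P div φ = Σ_j ⟪a_j, k_j⟫ ∫ 1_P(Φ_j y) χ_j(Φ_j y) dy`, whence
`Σ_j ⟪a_j, k_j⟫ ∫ 1_P(Φ_j y) χ_j(Φ_j y) dy ≤ P_K(P)` (`le_anisotropicPerimeter_hPolytope_of_cutoffs`,
THIS FILE); and (ii) TOPOLOGY (not here): for a polytope with nonempty interior, cut-offs `χ_j → 1` on
compact subsets exhausting the relative interiors of the facets exist (smooth Urysohn + inner regularity),
so that the right-hand sides tend to `Σ_j h_K(a_j) area(F_j)`.  Flat polytopes (empty interior) show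
that (ii) genuinely needs the interior: there `P_K(P) = 0` while the facet sum is positive.
[cite: EvansGariepy2015, Thm 5.16 (Gauss–Green); Maggi2012, (20.2) p. 258]
-/

noncomputable section

namespace Literature.Analysis.Convexity

open _root_.MeasureTheory Set Finset
open Literature.MathematicalPhysics.StatisticalMechanics (fieldDivergence)
open Literature.MeasureTheory.Integral

variable {ι : Type*} [LinearOrder ι]

omit [LinearOrder ι] in
/-- Sub-convex combinations stay in a convex set containing `0`: weights `w_j ≥ 0` with `Σ w_j ≤ 1`.
[cite: Maggi2012, (20.2) p. 258 — plumbing] -/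
theorem subconvex_sum_mem {V : Type*} [AddCommGroup V] [Module ℝ V] {K : Set V} (hK : Convex ℝ K)
    (h0 : (0 : V) ∈ K) {J : Finset ι} (w : ι → ℝ) (z : ι → V) (hw : ∀ j ∈ J, 0 ≤ w j)
    (hw1 : ∑ j ∈ J, w j ≤ 1) (hz : ∀ j ∈ J, z j ∈ K) : ∑ j ∈ J, w j • z j ∈ K := by
  set s := ∑ j ∈ J, w j with hs
  have hs0 : 0 ≤ s := Finset.sum_nonneg hw
  rcases hs0.eq_or_lt with hs00 | hspos
  · -- all weights vanish
    have hw0 : ∀ j ∈ J, w j = 0 := fun j hj =>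
      le_antisymm (by
        have := Finset.single_le_sum hw hj
        linarith) (hw j hj)
    rw [Finset.sum_eq_zero fun j hj => by rw [hw0 j hj, zero_smul]]
    exact h0
  · have hmem : ∑ j ∈ J, (w j / s) • z j ∈ K :=
      hK.sum_mem (fun j hj => div_nonneg (hw j hj) hs0) (by
        rw [← Finset.sum_div, div_self hspos.ne']) hz
    have heq : ∑ j ∈ J, w j • z j = s • ∑ j ∈ J, (w j / s) • z j := by
      rw [Finset.smul_sum]
      refine Finset.sum_congr rfl fun j _ => ?_
      rw [smul_smul, mul_div_cancel₀ _ hspos.ne']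
    rw [heq]
    exact hK.smul_mem_of_zero_mem h0 hmem ⟨hs0, hw1⟩

/-- **Lower facet bound given separated cut-offs** (see the module docstring).
[cite: EvansGariepy2015, Thm 5.16 (Gauss–Green), polyhedral case; Maggi2012, (20.2) p. 258] -/
theorem le_anisotropicPerimeter_hPolytope_of_cutoffs {J : Finset ι}
    (a : ι → Fin 3 → ℝ) (b : ι → ℝ) (ha1 : ∀ j ∈ J, ∑ l, a j l ^ 2 = 1)
    (hbd : ∀ i : Fin 3,
      (J.filter fun j => 0 < a j i).Nonempty ∧ (J.filter fun j => a j i < 0).Nonempty)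
    (hnd : ∀ j ∈ J, ∀ k ∈ J, j ≠ k → ¬ ∃ μ : ℝ, (∀ l, a k l = μ * a j l) ∧ b k = μ * b j)
    (p U V : ι → Fin 3 → ℝ) (hp : ∀ j ∈ J, ∑ l, a j l * p j l = b j)
    (hU : ∀ j ∈ J, ∑ l, a j l * U j l = 0) (hV : ∀ j ∈ J, ∑ l, a j l * V j l = 0)
    (hU1 : ∀ j ∈ J, ∑ l, U j l ^ 2 = 1) (hV1 : ∀ j ∈ J, ∑ l, V j l ^ 2 = 1)
    (hUV : ∀ j ∈ J, ∑ l, U j l * V j l = 0)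
    (hPc : IsCompact {x : Fin 3 → ℝ | ∀ j ∈ J, ∑ l, a j l * x l ≤ b j})
    {K : Set (EuclideanSpace ℝ (Fin 3))} (hK : Convex ℝ K) (hK0 : (0 : EuclideanSpace ℝ (Fin 3)) ∈ K)
    (kv : ι → EuclideanSpace ℝ (Fin 3)) (hkv : ∀ j ∈ J, kv j ∈ K)
    (χ : ι → EuclideanSpace ℝ (Fin 3) → ℝ) (hχ1 : ∀ j ∈ J, ContDiff ℝ 1 (χ j))
    (hχc : ∀ j ∈ J, HasCompactSupport (χ j)) (hχ0 : ∀ j ∈ J, ∀ x, 0 ≤ χ j x)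
    (hχs : ∀ x, ∑ j ∈ J, χ j x ≤ 1)
    (hsep : ∀ j ∈ J, ∀ k ∈ J, j ≠ k → ∀ x : Fin 3 → ℝ,
      x ∈ {x : Fin 3 → ℝ | ∀ j ∈ J, ∑ l, a j l * x l ≤ b j} → ∑ l, a k l * x l = b k →
        χ j (WithLp.toLp 2 x) = 0) :
    ENNReal.ofReal (∑ j ∈ J, (∑ l, a j l * kv j l) *
        ∫ y : ℝ × ℝ, {x : Fin 3 → ℝ | ∀ j ∈ J, ∑ l, a j l * x l ≤ b j}.indicator (fun _ => (1 : ℝ))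
          (p j + y.1 • U j + y.2 • V j) * χ j (WithLp.toLp 2 (p j + y.1 • U j + y.2 • V j))) ≤
      anisotropicPerimeter K {z : EuclideanSpace ℝ (Fin 3) | ∀ j ∈ J, ∑ l, a j l * z l ≤ b j} := by
  classical
  set P : Set (Fin 3 → ℝ) := {x | ∀ j ∈ J, ∑ l, a j l * x l ≤ b j} with hP
  have hpre : (WithLp.toLp 2 : (Fin 3 → ℝ) → EuclideanSpace ℝ (Fin 3)) ⁻¹'
      {z : EuclideanSpace ℝ (Fin 3) | ∀ j ∈ J, ∑ l, a j l * z l ≤ b j} = P := by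
    ext x; simp [hP]
  -- the field `φ = Σ_j χ_j • k_j`
  set φ : EuclideanSpace ℝ (Fin 3) → EuclideanSpace ℝ (Fin 3) := fun x => ∑ j ∈ J, χ j x • kv j
    with hφ
  have hφ1 : ContDiff ℝ 1 φ := ContDiff.sum fun j hj => (hχ1 j hj).smul contDiff_const
  have hφc : HasCompactSupport φ := by
    have key : ∀ s : Finset ι, s ⊆ J →
        HasCompactSupport (fun x : EuclideanSpace ℝ (Fin 3) => ∑ j ∈ s, χ j x • kv j) := by
      intro s
      induction s using Finset.induction_on with
      | empty =>
        intro _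
        rw [show (fun x : EuclideanSpace ℝ (Fin 3) => ∑ j ∈ (∅ : Finset ι), χ j x • kv j) = 0 from
          funext fun x => by simp]
        exact HasCompactSupport.zero
      | insert i s hi ih =>
        intro hsub
        simp_rw [Finset.sum_insert hi]
        refine HasCompactSupport.add ?_ (ih fun j hj => hsub (Finset.mem_insert_of_mem hj))
        exact (hχc i (hsub (Finset.mem_insert_self i s))).smul_right (f' := fun _ => kv i)
    exact key J le_rfl
  have hφK : ∀ x, φ x ∈ K := fun x =>
    subconvex_sum_mem hK hK0 (fun j => χ j x) kv (fun j hj => hχ0 j hj x) (hχs x) hkv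
  have hφapply : ∀ (z : EuclideanSpace ℝ (Fin 3)) (i : Fin 3), (φ z) i = ∑ k ∈ J, χ k z * kv k i := by
    intro z i
    simp [hφ, Finset.sum_apply, smul_eq_mul]
  refine le_trans (le_of_eq ?_) (le_anisotropicPerimeter hφ1 hφc hφK)
  congr 1
  rw [setIntegral_fieldDivergence_eq_coords, hpre,
    setIntegral_divergence_hPolytope_eq_facetSum a b ha1 hbd hnd p U V hp hU hV hU1 hV1 hUV hPc
      (η := fun i x => (φ (WithLp.toLp 2 x)) i)
      (dη := fun i x => (fderiv ℝ φ (WithLp.toLp 2 x) (EuclideanSpace.single i 1)) i)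
      (fun i => continuous_apply_toLp hφ1.continuous i)
      (fun i => continuous_fderiv_apply_toLp hφ1 i) (fun i x => hasDerivAt_apply_toLp_update hφ1 i x)]
  refine Finset.sum_congr rfl fun j hj => ?_
  -- on the `j`-th facet the field is `χ_j • k_j`
  have hplane : ∀ y : ℝ × ℝ, ∑ l, a j l * (p j + y.1 • U j + y.2 • V j) l = b j := by
    intro y
    have : ∀ l, a j l * (p j + y.1 • U j + y.2 • V j) l =
        a j l * p j l + y.1 * (a j l * U j l) + y.2 * (a j l * V j l) := by
      intro l; simp [smul_eq_mul]; ring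
    simp_rw [this, Finset.sum_add_distrib, ← Finset.mul_sum, hp j hj, hU j hj, hV j hj]
    ring
  have hval : ∀ y : ℝ × ℝ, p j + y.1 • U j + y.2 • V j ∈ P → ∀ i,
      (φ (WithLp.toLp 2 (p j + y.1 • U j + y.2 • V j))) i =
        χ j (WithLp.toLp 2 (p j + y.1 • U j + y.2 • V j)) * kv j i := by
    intro y hy i
    rw [hφapply, Finset.sum_eq_single_of_mem j hj]
    intro k hk hkj
    rw [hsep k hk j hj hkj _ hy (hplane y), zero_mul]
  have hint : ∀ i, ∫ y : ℝ × ℝ, P.indicator (fun _ => (1 : ℝ)) (p j + y.1 • U j + y.2 • V j) *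
      (φ (WithLp.toLp 2 (p j + y.1 • U j + y.2 • V j))) i =
      (∫ y : ℝ × ℝ, P.indicator (fun _ => (1 : ℝ)) (p j + y.1 • U j + y.2 • V j) *
        χ j (WithLp.toLp 2 (p j + y.1 • U j + y.2 • V j))) * kv j i := by
    intro i
    rw [← integral_mul_const]
    refine integral_congr_ae (Filter.Eventually.of_forall fun y => ?_)
    beta_reduce
    by_cases hy : p j + y.1 • U j + y.2 • V j ∈ P
    · rw [hval y hy i]; ring
    · rw [Set.indicator_of_notMem hy]; ring
  beta_reduce
  rw [← hP]
  simp_rw [hint]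
  rw [Finset.sum_mul]
  exact Finset.sum_congr rfl fun i _ => by ring

end Literature.Analysis.Convexity

end
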